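import Mathlib
import HarnessLib
import Literature.NumberTheory.LFunctions.MertensConstant
import Literature.NumberTheory.LFunctions.RosserSchoenfeldMertensFirstProofs

/-!
# Route `IntegerScrew` — the Mertens–Abel step of THEOREM C♯ (CONTINUUM-LIMIT 16.5 (a)):
# a prime sum `Σ_{p≤b} (log p/p)·g(log p/L)` against `L∫₀^{log b/L} g`, for monotone `g`

THEOREM C♯ (PIVOT-LAW 13.44 / CONTINUUM-LIMIT §16, rh-explicit A6-PIVOT theory) bounds the generator defect of
its comparison function through the exact decomposition 16.4, whose main term is

  `E_Mert := Σ_{q ≤ M/x prime} (log q/(qL))·F(θ_q) − ∫₀^ρ F(θ)dθ`,  `θ_q = log q/L`, `ρ = log(M/x)/L`,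

with `F` non-decreasing (`F(θ) = K(u,ρ−θ)(1 − e^{−uθ}) − K(u,ρ)`).  CONTINUUM-LIMIT 16.5 (a) bounds it by Abel
summation against `ϑ₁(t) := Σ_{p≤t} log p/p = log t + δ(t)`, `−E₂ ≤ δ ≤ 0` (Rosser–Schoenfeld (3.21)/(3.24)):

  `−E₂|F(ρ)| ≤ L·E_Mert ≤ E₂|F(ρ)| + E₂(F(ρ) − F(0))`.

This file proves that step for an ABSTRACT `C¹` function `g` with `g′ ≥ 0`, with the Mertens bound as a
HYPOTHESIS on `[1, b]` (nothing here cites or assumes a prime-number estimate; the walk application feeds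
Rosser–Schoenfeld's printed (3.21)/(3.24) as a named Literature fact and `g = F`, `b = M/x`):

* vocabulary: the tree's `ϑ₁ = Literature.NumberTheory.LFunctions.Mertens.primeLogDivSum` (`Σ_{p ≤ t} log p/p`) and
  `δ = Mertens.mertensTau = ϑ₁ − log` (MertensConstant.lean); no new definition is introduced here;
* `prime_sum_sub_integral_eq` : the EXACT identity, for every real `b ≥ 1` and `L ≠ 0`,
  `Σ_{p≤b}(log p/p)g(log p/L) − L∫₀^{log b/L}g = g(log b/L)·δ(b) − ∫₁^b g′(log t/L)/(tL)·δ(t)dt`, `δ = ϑ₁ − log`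
  (Abel summation `Mathlib.NumberTheory.AbelSummation` + one integration by parts + the substitution `θ = log t/L`);
* `le_prime_sum_sub_integral` / `prime_sum_sub_integral_le` : the two-sided bound above, given
  `−E₂ ≤ δ(t) ≤ 0` on `[1, b]`, `g′ ≥ 0` on `[0, log b/L]`, `L > 0`;
* `le_prime_sum_sub_integral_four` / `prime_sum_sub_integral_le_four` : the same UNCONDITIONALLY with `E₂ = 4`,
  feeding the tree's PROVED two-sided Mertens I (`MertensBound.sum_log_div_prime_bounds`: `ϑ₁(t) ≥ log t − 4`,
  Hardy–Wright Thm 425) and Rosser–Schoenfeld (3.24) PROVED in the tree (`RosserSchoenfeld1962_eq_3_24_holds`: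
  `ϑ₁(t) < log t`) — so THEOREM C♯'s `E_Mert` step needs NO named hypothesis in the kernel (constant `4` for `1.84`).

Real analysis only; RH-free and walk-free.  Nothing in this file bears on the truth of RH.
References: CONTINUUM-LIMIT §16.5 (a), §21.1 (K4), §22.6 (Rosser–Schoenfeld locators); PIVOT-LAW 13.44/13.50;
M. Suzuki, J. Lond. Math. Soc. (2) 108 (2023) 1448–1487 [Suzuki2023] for the screw matrices this serves.
-/

noncomputable section

-- D-0017: `Summit.<S>.<S>.…` is the designed namespace of a single-problem summit.
set_option linter.dupNamespace false

namespace Summit.RiemannHypothesis.RiemannHypothesis.Theorems.IntegerScrew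

open Real Finset MeasureTheory intervalIntegral Set

/-! ## `ϑ₁` in the shape of Mathlib's Abel summation -/

/-- The tree's `ϑ₁`: `primeLogDivSum t = Σ_{p ≤ t} log p/p`, as the Abel partial sum of the weights
`[k prime]·log k/k` over `Icc 0 ⌊t⌋₊`. -/
theorem sum_Icc_ite_eq_primeLogDivSum (t : ℝ) :
    ∑ k ∈ Finset.Icc 0 ⌊t⌋₊, (if k.Prime then Real.log k / k else 0) =
      Literature.NumberTheory.LFunctions.Mertens.primeLogDivSum t := by
  rw [Literature.NumberTheory.LFunctions.MertensBound.sum_Icc_ite_prime_log_div]; rfl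

/-- The weighted Abel sum over `Ioc 1 n` is the prime sum over `primesLE n` (the `k = 0, 1` weights vanish). -/
theorem sum_Ioc_one_ite_mul (n : ℕ) (h : ℕ → ℝ) :
    ∑ k ∈ Finset.Ioc 1 n, h k * (if k.Prime then Real.log k / k else 0) =
      ∑ p ∈ Nat.primesLE n, Real.log p / p * h p := by
  rw [Nat.primesLE_eq_filter_Ioc_zero, Finset.sum_filter]
  rcases Nat.eq_zero_or_pos n with rfl | hn
  · simp
  · have h2 : Finset.Ioc 0 n = insert 1 (Finset.Ioc 1 n) := by
      ext k; simp [Finset.mem_Ioc, Finset.mem_insert]; omega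
    rw [h2, Finset.sum_insert (by simp)]
    simp only [Nat.not_prime_one, if_false, zero_add]
    refine Finset.sum_congr rfl fun k _ => ?_
    split_ifs with hk
    · ring
    · simp

/-- `Σ_{k ∈ Icc 0 1} [k prime] log k/k = 0`. -/
theorem sum_Icc_zero_one_ite :
    ∑ k ∈ Finset.Icc (0 : ℕ) 1, (if k.Prime then Real.log k / k else (0 : ℝ)) = 0 := by
  rw [show Finset.Icc (0 : ℕ) 1 = {0, 1} by rfl]
  simp [Nat.not_prime_zero, Nat.not_prime_one]

/-! ## The functions `t ↦ g(log t/L)` and `t ↦ log t` on `[1, b]` -/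

section calculus

variable {L : ℝ} {g g' : ℝ → ℝ}

/-- `d/dt g(log t/L) = g′(log t/L)/(tL)` for `t ≠ 0`, `L ≠ 0`. -/
theorem hasDerivAt_comp_log_div (hL : L ≠ 0) (hg : ∀ θ, HasDerivAt g (g' θ) θ) {t : ℝ} (ht : t ≠ 0) :
    HasDerivAt (fun s : ℝ => g (Real.log s / L)) (g' (Real.log t / L) / (t * L)) t := by
  have h1 : HasDerivAt (fun s : ℝ => Real.log s / L) (t⁻¹ / L) t :=
    (Real.hasDerivAt_log ht).div_const L
  have h2 := (hg (Real.log t / L)).comp t h1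
  have e : g' (Real.log t / L) * (t⁻¹ / L) = g' (Real.log t / L) / (t * L) := by
    field_simp
  rw [← e]
  exact h2

/-- Points of `[[1, b]]` are positive when `1 ≤ b`. -/
theorem pos_of_mem_uIcc_one {b t : ℝ} (hb : 1 ≤ b) (ht : t ∈ uIcc (1 : ℝ) b) : 0 < t := by
  rw [uIcc_of_le hb] at ht
  exact lt_of_lt_of_le one_pos ht.1

/-- `t ↦ g(log t/L)` is continuous on `[1, b]` (`g` differentiable, `b ≥ 1`). -/
theorem continuousOn_comp_log_div (hg : ∀ θ, HasDerivAt g (g' θ) θ) {b : ℝ} (hb : 1 ≤ b) :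
    ContinuousOn (fun s : ℝ => g (Real.log s / L)) (uIcc 1 b) := by
  have hgc : Continuous g := continuous_iff_continuousAt.mpr fun θ => (hg θ).continuousAt
  refine hgc.comp_continuousOn ((continuousOn_log.mono ?_).div_const L)
  intro s hs
  exact (pos_of_mem_uIcc_one hb hs).ne'

/-- `t ↦ g′(log t/L)/(tL)` is continuous on `[1, b]` for `b ≥ 1`, `L ≠ 0` (`g′` continuous). -/
theorem continuousOn_deriv_comp_log_div (hL : L ≠ 0) (hg'c : Continuous g') {b : ℝ} (hb : 1 ≤ b) :
    ContinuousOn (fun s : ℝ => g' (Real.log s / L) / (s * L)) (uIcc 1 b) := by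
  have hpos : ∀ s ∈ uIcc (1 : ℝ) b, s ≠ 0 := fun s hs => (pos_of_mem_uIcc_one hb hs).ne'
  refine ContinuousOn.div ?_ (continuousOn_id.mul continuousOn_const) fun s hs => mul_ne_zero (hpos s hs) hL
  exact hg'c.comp_continuousOn ((continuousOn_log.mono hpos).div_const L)

/-- The substitution `θ = log t/L`: `∫₁^b g(log t/L)·t⁻¹ dt = L·∫₀^{log b/L} g(θ)dθ` (`b ≥ 1`, `L ≠ 0`). -/
theorem integral_comp_log_div_mul_inv (hL : L ≠ 0) (hg : ∀ θ, HasDerivAt g (g' θ) θ) {b : ℝ} (hb : 1 ≤ b) :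
    ∫ t in (1 : ℝ)..b, g (Real.log t / L) * t⁻¹ = L * ∫ θ in (0 : ℝ)..(Real.log b / L), g θ := by
  have hgc : Continuous g := continuous_iff_continuousAt.mpr fun θ => (hg θ).continuousAt
  have hφ : ∀ x ∈ uIcc (1 : ℝ) b, HasDerivAt (fun s : ℝ => Real.log s / L) (x⁻¹ / L) x :=
    fun x hx => (Real.hasDerivAt_log (pos_of_mem_uIcc_one hb hx).ne').div_const L
  have hφ' : ContinuousOn (fun x : ℝ => x⁻¹ / L) (uIcc 1 b) := by
    refine (continuousOn_inv₀.mono ?_).div_const L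
    intro x hx; exact (pos_of_mem_uIcc_one hb hx).ne'
  have hsub := intervalIntegral.integral_comp_mul_deriv hφ hφ' hgc
  -- hsub : ∫ x in 1..b, (g ∘ (log ·/L)) x * (x⁻¹/L) = ∫ u in (log 1/L)..(log b/L), g u
  rw [Real.log_one, zero_div] at hsub
  rw [← hsub, ← intervalIntegral.integral_const_mul]
  refine intervalIntegral.integral_congr fun x _ => ?_
  simp only [Function.comp_apply]
  field_simp

/-- Integration by parts against `log`: `∫₁^b g(log t/L)·t⁻¹ dt = g(log b/L)·log b − ∫₁^b g′(log t/L)/(tL)·log t dt`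
(`b ≥ 1`, `L ≠ 0`, `g′` continuous). -/
theorem integral_comp_log_div_mul_inv_eq_parts (hL : L ≠ 0) (hg : ∀ θ, HasDerivAt g (g' θ) θ)
    (hg'c : Continuous g') {b : ℝ} (hb : 1 ≤ b) :
    ∫ t in (1 : ℝ)..b, g (Real.log t / L) * t⁻¹ =
      g (Real.log b / L) * Real.log b
        - ∫ t in (1 : ℝ)..b, g' (Real.log t / L) / (t * L) * Real.log t := by
  have hmin : min (1 : ℝ) b = 1 := min_eq_left hb
  have hmax : max (1 : ℝ) b = b := max_eq_right hb
  have hparts := intervalIntegral.integral_mul_deriv_eq_deriv_mul_of_hasDerivAt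
    (u := fun s : ℝ => g (Real.log s / L)) (v := Real.log)
    (u' := fun s : ℝ => g' (Real.log s / L) / (s * L)) (v' := fun s : ℝ => s⁻¹) (a := 1) (b := b)
    (continuousOn_comp_log_div hg hb)
    (continuousOn_log.mono fun s hs => (pos_of_mem_uIcc_one hb hs).ne')
    (fun x hx => by
      rw [hmin, hmax] at hx
      exact hasDerivAt_comp_log_div hL hg (lt_trans one_pos hx.1).ne')
    (fun x hx => by
      rw [hmin, hmax] at hx
      exact Real.hasDerivAt_log (lt_trans one_pos hx.1).ne')
    ((continuousOn_deriv_comp_log_div hL hg'c hb).intervalIntegrable)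
    ((continuousOn_inv₀.mono fun s hs => (pos_of_mem_uIcc_one hb hs).ne').intervalIntegrable)
  rw [hparts, Real.log_one, mul_zero, sub_zero]

end calculus

/-! ## Abel summation against `ϑ₁` and the exact identity -/

/-- **The exact identity** (CONTINUUM-LIMIT 16.5 (a), before any bound): for `b ≥ 1`, `L ≠ 0`, `g ∈ C¹`,
`Σ_{p ≤ b} (log p/p)·g(log p/L) − L∫₀^{log b/L} g = g(log b/L)(ϑ₁(b) − log b) − ∫₁^b g′(log t/L)/(tL)·(ϑ₁(t) − log t)dt`. -/
theorem prime_sum_sub_integral_eq {L : ℝ} (hL : L ≠ 0) {g g' : ℝ → ℝ} (hg : ∀ θ, HasDerivAt g (g' θ) θ)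
    (hg'c : Continuous g') {b : ℝ} (hb : 1 ≤ b) :
    (∑ p ∈ Nat.primesLE ⌊b⌋₊, Real.log p / p * g (Real.log p / L))
      - L * ∫ θ in (0 : ℝ)..(Real.log b / L), g θ =
      g (Real.log b / L) * (Literature.NumberTheory.LFunctions.Mertens.primeLogDivSum b - Real.log b)
        - ∫ t in (1 : ℝ)..b, g' (Real.log t / L) / (t * L) * (Literature.NumberTheory.LFunctions.Mertens.primeLogDivSum t - Real.log t) := by
  -- (1) Abel summation on [1, b] for f(s) = g(log s/L)
  have hf_diff : ∀ t ∈ Set.Icc (1 : ℝ) b, DifferentiableAt ℝ (fun s : ℝ => g (Real.log s / L)) t :=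
    fun t ht => (hasDerivAt_comp_log_div hL hg (lt_of_lt_of_le one_pos ht.1).ne').differentiableAt
  have hderiv : ∀ t ∈ Set.Icc (1 : ℝ) b,
      deriv (fun s : ℝ => g (Real.log s / L)) t = g' (Real.log t / L) / (t * L) := fun t ht =>
    (hasDerivAt_comp_log_div hL hg (lt_of_lt_of_le one_pos ht.1).ne').deriv
  have hcont : ContinuousOn (fun s : ℝ => g' (Real.log s / L) / (s * L)) (Set.Icc 1 b) := by
    have := continuousOn_deriv_comp_log_div hL hg'c hb
    rwa [uIcc_of_le hb] at this
  have hf_int : IntegrableOn (deriv (fun s : ℝ => g (Real.log s / L))) (Set.Icc 1 b) :=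
    (hcont.integrableOn_Icc).congr_fun (fun t ht => (hderiv t ht).symm) measurableSet_Icc
  have habel := sum_mul_eq_sub_sub_integral_mul (fun k : ℕ => if k.Prime then Real.log k / k else (0 : ℝ))
    zero_le_one hb hf_diff hf_int
  rw [Nat.floor_one, sum_Icc_zero_one_ite, mul_zero, sub_zero, sum_Ioc_one_ite_mul] at habel
  simp only [sum_Icc_ite_eq_primeLogDivSum] at habel
  -- habel : Σ_{p ≤ ⌊b⌋} log p/p * g(log p/L) = g(log b/L) * ϑ₁(b) - ∫ t in Ioc 1 b, deriv f t * ϑ₁ t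
  have hI : ∫ t in Set.Ioc 1 b, deriv (fun s : ℝ => g (Real.log s / L)) t * Literature.NumberTheory.LFunctions.Mertens.primeLogDivSum t =
      ∫ t in (1 : ℝ)..b, g' (Real.log t / L) / (t * L) * Literature.NumberTheory.LFunctions.Mertens.primeLogDivSum t := by
    rw [intervalIntegral.integral_of_le hb]
    refine setIntegral_congr_fun measurableSet_Ioc fun t ht => ?_
    show deriv (fun s : ℝ => g (Real.log s / L)) t * Literature.NumberTheory.LFunctions.Mertens.primeLogDivSum t = _
    rw [hderiv t ⟨ht.1.le, ht.2⟩]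
  -- (2) the plain integral by substitution and by parts
  have hsub := integral_comp_log_div_mul_inv hL hg hb
  have hparts := integral_comp_log_div_mul_inv_eq_parts hL hg hg'c hb
  -- (3) integrability for splitting the last integral
  have hi1 : IntervalIntegrable (fun t : ℝ => g' (Real.log t / L) / (t * L) * Literature.NumberTheory.LFunctions.Mertens.primeLogDivSum t) volume 1 b := by
    have h := integrableOn_mul_sum_Icc (fun k : ℕ => if k.Prime then Real.log k / k else (0 : ℝ)) (m := 0) zero_le_one
      (g := fun t => g' (Real.log t / L) / (t * L))
      hcont.integrableOn_Icc
    simp only [sum_Icc_ite_eq_primeLogDivSum] at h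
    exact (intervalIntegrable_iff_integrableOn_Icc_of_le hb).mpr h
  have hi2 : IntervalIntegrable (fun t : ℝ => g' (Real.log t / L) / (t * L) * Real.log t) volume 1 b := by
    refine ContinuousOn.intervalIntegrable ?_
    rw [uIcc_of_le hb]
    exact hcont.mul (continuousOn_log.mono fun s hs => (lt_of_lt_of_le one_pos hs.1).ne')
  have hsplit : ∫ t in (1 : ℝ)..b, g' (Real.log t / L) / (t * L) * (Literature.NumberTheory.LFunctions.Mertens.primeLogDivSum t - Real.log t) =
      (∫ t in (1 : ℝ)..b, g' (Real.log t / L) / (t * L) * Literature.NumberTheory.LFunctions.Mertens.primeLogDivSum t)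
        - ∫ t in (1 : ℝ)..b, g' (Real.log t / L) / (t * L) * Real.log t := by
    rw [← intervalIntegral.integral_sub hi1 hi2]
    refine intervalIntegral.integral_congr fun t _ => ?_
    ring
  -- (4) assemble
  have hS : (∑ p ∈ Nat.primesLE ⌊b⌋₊, Real.log p / p * g (Real.log p / L)) =
      g (Real.log b / L) * Literature.NumberTheory.LFunctions.Mertens.primeLogDivSum b - ∫ t in (1 : ℝ)..b, g' (Real.log t / L) / (t * L) * Literature.NumberTheory.LFunctions.Mertens.primeLogDivSum t := by
    rw [← hI]
    exact habel
  rw [hS, ← hsub, hparts, hsplit]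
  ring

/-! ## The two-sided Mertens–Abel bound -/

/-- The correction integral is between `0` and `E₂(g(log b/L) − g(0))` when `−E₂ ≤ ϑ₁ − log ≤ 0` on `[1,b]` and
`g′ ≥ 0` on `[0, log b/L]` (`L > 0`, `b ≥ 1`). -/
theorem correction_integral_bounds {L : ℝ} (hL : 0 < L) {g g' : ℝ → ℝ} (hg : ∀ θ, HasDerivAt g (g' θ) θ)
    (hg'c : Continuous g') {b E₂ : ℝ} (hb : 1 ≤ b)
    (hδ : ∀ t ∈ Set.Icc (1 : ℝ) b, -E₂ ≤ Literature.NumberTheory.LFunctions.Mertens.primeLogDivSum t - Real.log t ∧ Literature.NumberTheory.LFunctions.Mertens.primeLogDivSum t - Real.log t ≤ 0)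
    (hmono : ∀ θ ∈ Set.Icc (0 : ℝ) (Real.log b / L), 0 ≤ g' θ) :
    0 ≤ -∫ t in (1 : ℝ)..b, g' (Real.log t / L) / (t * L) * (Literature.NumberTheory.LFunctions.Mertens.primeLogDivSum t - Real.log t) ∧
      -∫ t in (1 : ℝ)..b, g' (Real.log t / L) / (t * L) * (Literature.NumberTheory.LFunctions.Mertens.primeLogDivSum t - Real.log t)
        ≤ E₂ * (g (Real.log b / L) - g 0) := by
  have hLne : L ≠ 0 := hL.ne'
  have hcont : ContinuousOn (fun s : ℝ => g' (Real.log s / L) / (s * L)) (Set.Icc 1 b) := by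
    have := continuousOn_deriv_comp_log_div hLne hg'c hb
    rwa [uIcc_of_le hb] at this
  -- the weight w(t) = g'(log t/L)/(tL) is ≥ 0 on [1,b]
  have hw : ∀ t ∈ Set.Icc (1 : ℝ) b, 0 ≤ g' (Real.log t / L) / (t * L) := by
    intro t ht
    have ht0 : 0 < t := lt_of_lt_of_le one_pos ht.1
    refine div_nonneg (hmono _ ⟨?_, ?_⟩) (mul_pos ht0 hL).le
    · exact div_nonneg (Real.log_nonneg ht.1) hL.le
    · exact div_le_div_of_nonneg_right (Real.log_le_log ht0 ht.2) hL.le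
  -- ∫ w = g(ρ) − g(0)
  have hFTC : ∫ t in (1 : ℝ)..b, g' (Real.log t / L) / (t * L) = g (Real.log b / L) - g 0 := by
    have := intervalIntegral.integral_eq_sub_of_hasDerivAt
      (f := fun s : ℝ => g (Real.log s / L)) (f' := fun s => g' (Real.log s / L) / (s * L)) (a := 1) (b := b)
      (fun t ht => hasDerivAt_comp_log_div hLne hg (pos_of_mem_uIcc_one hb ht).ne')
      ((continuousOn_deriv_comp_log_div hLne hg'c hb).intervalIntegrable)
    simpa [Real.log_one] using this
  have hi1 : IntervalIntegrable (fun t : ℝ => g' (Real.log t / L) / (t * L) * Literature.NumberTheory.LFunctions.Mertens.primeLogDivSum t) volume 1 b := by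
    have h := integrableOn_mul_sum_Icc (fun k : ℕ => if k.Prime then Real.log k / k else (0 : ℝ)) (m := 0) zero_le_one
      (g := fun t => g' (Real.log t / L) / (t * L))
      hcont.integrableOn_Icc
    simp only [sum_Icc_ite_eq_primeLogDivSum] at h
    exact (intervalIntegrable_iff_integrableOn_Icc_of_le hb).mpr h
  have hi2 : IntervalIntegrable (fun t : ℝ => g' (Real.log t / L) / (t * L) * Real.log t) volume 1 b := by
    refine ContinuousOn.intervalIntegrable ?_
    rw [uIcc_of_le hb]
    exact hcont.mul (continuousOn_log.mono fun s hs => (lt_of_lt_of_le one_pos hs.1).ne')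
  have hiδ : IntervalIntegrable (fun t : ℝ => g' (Real.log t / L) / (t * L) * (Literature.NumberTheory.LFunctions.Mertens.primeLogDivSum t - Real.log t))
      volume 1 b := by
    refine (hi1.sub hi2).congr ?_
    intro t _
    simp only
    ring
  have hiw : IntervalIntegrable (fun t : ℝ => g' (Real.log t / L) / (t * L)) volume 1 b :=
    (continuousOn_deriv_comp_log_div hLne hg'c hb).intervalIntegrable
  constructor
  · -- −(integrand) ≥ 0 pointwise ⇒ −∫ ≥ 0
    rw [← intervalIntegral.integral_neg]
    refine intervalIntegral.integral_nonneg hb fun t ht => ?_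
    have h1 := hw t ht
    have h2 := (hδ t ht).2
    nlinarith
  · -- −∫ wδ ≤ E₂ ∫ w = E₂ (g ρ − g 0): pointwise −wδ ≤ E₂ w
    rw [← hFTC, ← intervalIntegral.integral_const_mul, ← intervalIntegral.integral_neg]
    refine intervalIntegral.integral_mono_on hb hiδ.neg (hiw.const_mul E₂) fun t ht => ?_
    have h1 := hw t ht
    have h2 := (hδ t ht).1
    nlinarith

/-- **Mertens–Abel, lower bound** (CONTINUUM-LIMIT 16.5 (a)): under the hypotheses above,
`−E₂·|g(log b/L)| ≤ Σ_{p≤b}(log p/p)g(log p/L) − L∫₀^{log b/L} g`. -/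
theorem le_prime_sum_sub_integral {L : ℝ} (hL : 0 < L) {g g' : ℝ → ℝ} (hg : ∀ θ, HasDerivAt g (g' θ) θ)
    (hg'c : Continuous g') {b E₂ : ℝ} (hb : 1 ≤ b)
    (hδ : ∀ t ∈ Set.Icc (1 : ℝ) b, -E₂ ≤ Literature.NumberTheory.LFunctions.Mertens.primeLogDivSum t - Real.log t ∧ Literature.NumberTheory.LFunctions.Mertens.primeLogDivSum t - Real.log t ≤ 0)
    (hmono : ∀ θ ∈ Set.Icc (0 : ℝ) (Real.log b / L), 0 ≤ g' θ) :
    -(E₂ * |g (Real.log b / L)|) ≤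
      (∑ p ∈ Nat.primesLE ⌊b⌋₊, Real.log p / p * g (Real.log p / L))
        - L * ∫ θ in (0 : ℝ)..(Real.log b / L), g θ := by
  rw [prime_sum_sub_integral_eq hL.ne' hg hg'c hb]
  obtain ⟨h0, _⟩ := correction_integral_bounds hL hg hg'c hb hδ hmono
  have hb' := hδ b ⟨hb, le_rfl⟩
  -- g(ρ)·δ(b) ≥ −E₂|g(ρ)|
  have key : -(E₂ * |g (Real.log b / L)|) ≤ g (Real.log b / L) * (Literature.NumberTheory.LFunctions.Mertens.primeLogDivSum b - Real.log b) := by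
    rcases le_or_gt 0 (g (Real.log b / L)) with hg0 | hg0
    · rw [abs_of_nonneg hg0]; nlinarith [hb'.1]
    · rw [abs_of_neg hg0]; nlinarith [hb'.2]
  linarith

/-- **Mertens–Abel, upper bound** (CONTINUUM-LIMIT 16.5 (a)):
`Σ_{p≤b}(log p/p)g(log p/L) − L∫₀^{log b/L} g ≤ E₂·|g(log b/L)| + E₂·(g(log b/L) − g(0))`. -/
theorem prime_sum_sub_integral_le {L : ℝ} (hL : 0 < L) {g g' : ℝ → ℝ} (hg : ∀ θ, HasDerivAt g (g' θ) θ)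
    (hg'c : Continuous g') {b E₂ : ℝ} (hb : 1 ≤ b)
    (hδ : ∀ t ∈ Set.Icc (1 : ℝ) b, -E₂ ≤ Literature.NumberTheory.LFunctions.Mertens.primeLogDivSum t - Real.log t ∧ Literature.NumberTheory.LFunctions.Mertens.primeLogDivSum t - Real.log t ≤ 0)
    (hmono : ∀ θ ∈ Set.Icc (0 : ℝ) (Real.log b / L), 0 ≤ g' θ) :
    (∑ p ∈ Nat.primesLE ⌊b⌋₊, Real.log p / p * g (Real.log p / L))
        - L * ∫ θ in (0 : ℝ)..(Real.log b / L), g θ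
      ≤ E₂ * |g (Real.log b / L)| + E₂ * (g (Real.log b / L) - g 0) := by
  rw [prime_sum_sub_integral_eq hL.ne' hg hg'c hb]
  obtain ⟨_, h1⟩ := correction_integral_bounds hL hg hg'c hb hδ hmono
  have hb' := hδ b ⟨hb, le_rfl⟩
  have key : g (Real.log b / L) * (Literature.NumberTheory.LFunctions.Mertens.primeLogDivSum b - Real.log b) ≤ E₂ * |g (Real.log b / L)| := by
    rcases le_or_gt 0 (g (Real.log b / L)) with hg0 | hg0
    · rw [abs_of_nonneg hg0]; nlinarith [hb'.2]
    · rw [abs_of_neg hg0]; nlinarith [hb'.1]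
  linarith

/-! ## Unconditional form: the tree's Mertens bounds give `−4 ≤ δ ≤ 0` on `[1, ∞)` -/

/-- `−4 ≤ ϑ₁(t) − log t ≤ 0` for real `t ≥ 1`, from the tree's PROVED facts: Hardy–Wright Thm 425 in the form
`MertensBound.sum_log_div_prime_bounds` (lower) and Rosser–Schoenfeld (3.24) `RosserSchoenfeld1962_eq_3_24_holds`
(upper, strict for `t > 1`; equality `0 = 0` at `t = 1`). -/
theorem mertensTau_mem_Icc {t : ℝ} (ht : 1 ≤ t) :
    -4 ≤ Literature.NumberTheory.LFunctions.Mertens.primeLogDivSum t - Real.log t ∧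
      Literature.NumberTheory.LFunctions.Mertens.primeLogDivSum t - Real.log t ≤ 0 := by
  constructor
  · have h := (Literature.NumberTheory.LFunctions.MertensBound.sum_log_div_prime_bounds ht).1
    unfold Literature.NumberTheory.LFunctions.Mertens.primeLogDivSum
    linarith
  · unfold Literature.NumberTheory.LFunctions.Mertens.primeLogDivSum
    rcases eq_or_lt_of_le ht with h1 | h1
    · rw [← h1, Nat.floor_one, Nat.primesLE_one, Finset.sum_empty, Real.log_one]
      norm_num
    · have h := Literature.NumberTheory.LFunctions.RosserSchoenfeld1962_eq_3_24_holds t h1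
      linarith

/-- **Mertens–Abel, lower bound, UNCONDITIONAL** (`E₂ = 4`): for `L > 0`, `b ≥ 1`, `g ∈ C¹` with `g′ ≥ 0` on
`[0, log b/L]`: `−4|g(log b/L)| ≤ Σ_{p≤b}(log p/p)g(log p/L) − L∫₀^{log b/L} g`. -/
theorem le_prime_sum_sub_integral_four {L : ℝ} (hL : 0 < L) {g g' : ℝ → ℝ} (hg : ∀ θ, HasDerivAt g (g' θ) θ)
    (hg'c : Continuous g') {b : ℝ} (hb : 1 ≤ b) (hmono : ∀ θ ∈ Set.Icc (0 : ℝ) (Real.log b / L), 0 ≤ g' θ) :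
    -(4 * |g (Real.log b / L)|) ≤
      (∑ p ∈ Nat.primesLE ⌊b⌋₊, Real.log p / p * g (Real.log p / L))
        - L * ∫ θ in (0 : ℝ)..(Real.log b / L), g θ :=
  le_prime_sum_sub_integral hL hg hg'c hb (fun _ ht => mertensTau_mem_Icc ht.1) hmono

/-- **Mertens–Abel, upper bound, UNCONDITIONAL** (`E₂ = 4`):
`Σ_{p≤b}(log p/p)g(log p/L) − L∫₀^{log b/L} g ≤ 4|g(log b/L)| + 4(g(log b/L) − g(0))`. -/
theorem prime_sum_sub_integral_le_four {L : ℝ} (hL : 0 < L) {g g' : ℝ → ℝ} (hg : ∀ θ, HasDerivAt g (g' θ) θ)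
    (hg'c : Continuous g') {b : ℝ} (hb : 1 ≤ b) (hmono : ∀ θ ∈ Set.Icc (0 : ℝ) (Real.log b / L), 0 ≤ g' θ) :
    (∑ p ∈ Nat.primesLE ⌊b⌋₊, Real.log p / p * g (Real.log p / L))
        - L * ∫ θ in (0 : ℝ)..(Real.log b / L), g θ
      ≤ 4 * |g (Real.log b / L)| + 4 * (g (Real.log b / L) - g 0) :=
  prime_sum_sub_integral_le hL hg hg'c hb (fun _ ht => mertensTau_mem_Icc ht.1) hmono

/-- The natural-number form used by the walk (`b = M/x`): `⌊(M:ℝ)/x⌋₊ = M/x`, so the prime sum above is the sum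
over the primes `q ≤ M/x` of 16.4, and `log b/L = (log M − log x)/L` is the room `ρ_x` when `L = log M`. -/
theorem floor_natCast_div (M x : ℕ) : ⌊(M : ℝ) / x⌋₊ = M / x := Nat.floor_div_eq_div M x

end Summit.RiemannHypothesis.RiemannHypothesis.Theorems.IntegerScrew

end
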